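import Literature.Computability.QuantumComplexity.CliffordGaussSums
import Literature.Computability.QuantumComplexity.CliffordTPathSums
import HarnessLib

/-!
# Symbolic (affine-form) path sums for Clifford+`T` circuits

Topic `Literature/Computability/QuantumComplexity`, sub-namespace `BravyiGosset`, sequel of
`CliffordGaussSums.lean` (second file towards `BravyiGosset2016_estimateAcceptProb_holds`).

The Feynman path sum of a Clifford+`T` circuit `U` (gate list over `H, S, T, CNOT`, first gate
first) on a basis state has one free bit per Hadamard gate; all other gates act deterministically
on basis labels. Introducing one `𝔽₂`-variable `w_k` for the `k`-th Hadamard gate, every wire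
carries at every time an **affine form** in `w`, the `S` gates contribute phases `i^{[form]}`, the
Hadamard gates phases `(−1)^{[in-form] · w_k}` — both of the shape `i^{linear} (−1)^{quadratic}`
handled by `GData` — and the `T` gates phases `ω^{[form]}`, `ω = e^{iπ/4}`, which are merely
*recorded* (their forms are the input of Bravyi–Gosset's magic-state decomposition in the sequel).
This "sum over paths with affine labels" is the standard phase-polynomial / sum-over-paths
description of Clifford(+`T`) circuits (Dehaene–De Moor 2003, §IV; Montanaro 2017, §2 eq. (1);
Bravyi–Gosset 2016, §II and App. B–C work with the equivalent standard forms `|K, q⟩`).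

* `BravyiGosset.SymGate`, `toSymGate` — gates with natural-number wire indices;
* `BravyiGosset.SymState` — wire forms, the accumulated Clifford phase data `GData`, the list of
  `T`-forms, and the variable counter; `symStep`, `symExec` (a left fold, as the machine runs it);
* `SymState.label w`, `SymState.phase V w` — the basis label and the phase of the path `w`;
* `SymState.Supp` — "no form mentions a variable `≥ nv`", preserved by `symStep`;
* **`symExec_spec`** — for an oracle-free gate list `gs` with `h'` Hadamard gates and a state
  `σ` (counter `k`): `(1/√2)^{h'} Σ_{v ∈ 𝔽₂^{h'}} phase_{σ'}(w[k.. := v]) |label_{σ'}(w[k.. := v])⟩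
  = phase_σ(w) · U_{gs} |label_σ(w)⟩`, where `σ' = symExec gs σ` and `w[k.. := v]` overrides the
  variables `k, …, k + h' − 1` of the ambient valuation `w` (`ovr`); and its corollary
  **`prodZeta_apply_eq_sum`**: `⟨z| U |y⟩ = (1/√2)^h Σ_{v ∈ 𝔽₂^h} [label(v) = z] · phase(v)` from the
  initial state `symInit y`.

## References

* S. Bravyi, D. Gosset, *Improved classical simulation of quantum circuits dominated by Clifford
  gates*, Phys. Rev. Lett. 116 (2016) 250501, arXiv:1601.07601v3, §II and App. A–C.
* J. Dehaene, B. De Moor, *Clifford group, stabilizer states, and linear and quadratic operations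
  over GF(2)*, Phys. Rev. A 68 (2003) 042318, §IV.
* A. Montanaro, *Quantum circuits and low-degree polynomials over `𝔽₂`*, J. Phys. A 50 (2017)
  084002, §2 (the path sum of a circuit over `H`, `Z`, `CZ`, … as an exponential sum of a
  low-degree polynomial over `𝔽₂`).
* M. A. Nielsen, I. L. Chuang, *Quantum Computation and Quantum Information*, CUP 2010, §4.2.
-/

noncomputable section

namespace Literature.Computability.QuantumComplexity.BravyiGosset

open Complex Finset _root_.Computability Literature.Computability.Complexity
  Literature.Computability.Cryptography Matrix

/-! ### Unused variables of `GData` -/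

namespace GData

/-- Entries of `crossRows` at all positions. [folklore] -/
theorem getD_crossRows_all (u v : List Bool) (l j : ℕ) :
    ((crossRows u v).getD l []).getD j false = (decide (j < l) && u.getD l false && v.getD j false) := by
  by_cases hjl : j < l
  · rw [getD_crossRows u v hjl]; simp [hjl]
  · unfold crossRows
    rw [getD_map_range]
    by_cases hl : l < u.length
    · rw [if_pos hl, getD_map_range, if_neg hjl]; simp [hjl]
    · rw [if_neg hl, List.getD_nil]; simp [hjl]

/-- `Λ` of `addPhaseForm` at all positions. [folklore] -/
theorem lamAt_addPhaseForm (κ : ℕ) (f : AffForm) (D : GData) (j : ℕ) :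
    (addPhaseForm κ f D).lamAt j =
      (D.lamAt j + if f.coef j then κ * (1 + 2 * Bool.toNat f.c) % 4 else 0) % 4 := by
  unfold addPhaseForm lamAt
  rw [getD_addMod4, getD_scaleList]
  rfl

/-- Entries of `addPhaseForm` at all positions. [folklore] -/
theorem entry_addPhaseForm (κ : ℕ) (f : AffForm) (D : GData) (l j : ℕ) :
    (addPhaseForm κ f D).entry l j =
      (D.entry l j ^^ (decide (κ % 2 = 1) && decide (j < l) && f.coef l && f.coef j)) := by
  unfold addPhaseForm entry
  by_cases hκ : κ % 2 = 1
  · simp only [hκ, if_true, decide_true, Bool.true_and]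
    rw [getD_xorRows, AffForm.getD_bxor, getD_crossRows_all]
    rfl
  · simp only [hκ, if_false, decide_false, Bool.false_and, Bool.xor_false]

/-- `Λ` of `addQuadProduct` at all positions. [folklore] -/
theorem lamAt_addQuadProduct (f g : AffForm) (D : GData) (j : ℕ) :
    (addQuadProduct f g D).lamAt j =
      (D.lamAt j + 2 * (Bool.toNat (f.c && g.coef j) + Bool.toNat (g.c && f.coef j) + Bool.toNat (f.coef j && g.coef j)) % 4) % 4 := by
  unfold addQuadProduct lamAt
  rw [getD_addMod4, getD_quadLin]

/-- Entries of `addQuadProduct` at all positions. [folklore] -/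
theorem entry_addQuadProduct (f g : AffForm) (D : GData) (l j : ℕ) :
    (addQuadProduct f g D).entry l j =
      (D.entry l j ^^ (decide (j < l) && ((f.coef l && g.coef j) ^^ (g.coef l && f.coef j)))) := by
  unfold addQuadProduct entry
  simp only
  rw [getD_xorRows, AffForm.getD_bxor, getD_xorRows, AffForm.getD_bxor, getD_crossRows_all,
    getD_crossRows_all]
  unfold AffForm.coef
  cases (D.B.getD l []).getD j false <;> cases decide (j < l) <;> cases f.a.getD l false <;>
    cases f.a.getD j false <;> cases g.a.getD l false <;> cases g.a.getD j false <;> rfl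

/-- The variable `w_p` does not occur in `D` (as far as the value at any number of ambient
variables is concerned): `Λ_p = 0`, `B_{pj} = 0` for `j < p`, `B_{lp} = 0` for `l > p`. [folklore] -/
def Unused (D : GData) (p : ℕ) : Prop :=
  D.lamAt p = 0 ∧ (∀ j, j < p → D.entry p j = false) ∧ ∀ l, p < l → D.entry l p = false

/-- The empty data uses no variable. [folklore] -/
theorem unused_empty (mu p : ℕ) : Unused ⟨mu, [], []⟩ p :=
  ⟨rfl, fun _ _ => rfl, fun _ _ => by simp [entry]⟩

/-- If `w_p` is unused, the value does not depend on `w_p`. [folklore] -/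
theorem val_update_of_unused {k : ℕ} (D : GData) {p : Fin k} (hp : D.Unused p) (w : Fin k → Bool)
    (c : Bool) : D.val k (Function.update w p c) = D.val k w := by
  have hcol : ∀ u : Fin k → Bool, (colrow k p D).eval u = false := by
    intro u
    have hcoef : ∀ j, (colrow k p D).coef j = false := by
      intro j
      rw [coef_colrow]
      by_cases hj : j < k
      · rw [if_pos hj]
        rcases Nat.lt_trichotomy j p with h | h | h
        · rw [if_pos h]; exact hp.2.1 j h
        · rw [if_neg (by omega), if_pos h]
        · rw [if_neg (by omega), if_neg (by omega)]; exact hp.2.2 j h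
      · rw [if_neg hj]
    rw [AffForm.eval_congr (f := colrow k p D) (g := AffForm.const false) rfl
      (fun j => by rw [hcoef, AffForm.coef_const]) u, AffForm.eval_const]
  have key : ∀ u : Bool, D.val k (Function.update w p u) = D.val k (Function.update w p false) := by
    intro u
    rw [D.val_update w p u, hp.1, hcol]
    simp
  rw [key c, ← key (w p), Function.update_eq_self]

/-- `addPhaseForm` with a form not mentioning `w_p` keeps `w_p` unused. [folklore] -/
theorem Unused.addPhaseForm {D : GData} {p : ℕ} (h : D.Unused p) (κ : ℕ) {f : AffForm}
    (hf : f.coef p = false) : (GData.addPhaseForm κ f D).Unused p := by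
  refine ⟨?_, fun j hj => ?_, fun l hl => ?_⟩
  · rw [lamAt_addPhaseForm, h.1, hf]; rfl
  · rw [entry_addPhaseForm, h.2.1 j hj, hf]; simp
  · rw [entry_addPhaseForm, h.2.2 l hl, hf]; simp

/-- `addQuadProduct` with forms not mentioning `w_p` keeps `w_p` unused. [folklore] -/
theorem Unused.addQuadProduct {D : GData} {p : ℕ} (h : D.Unused p) {f g : AffForm}
    (hf : f.coef p = false) (hg : g.coef p = false) : (GData.addQuadProduct f g D).Unused p := by
  refine ⟨?_, fun j hj => ?_, fun l hl => ?_⟩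
  · rw [lamAt_addQuadProduct, h.1, hf, hg]; simp
  · rw [entry_addQuadProduct, h.2.1 j hj, hf, hg]; simp
  · rw [entry_addQuadProduct, h.2.2 l hl, hf, hg]; simp

end GData

/-! ### Symbolic gates and states -/

/-- A Clifford+`T` gate with natural-number wire indices (`skip` for oracle gates, which have no
symbolic semantics). [folklore] -/
inductive SymGate
  | H (j : ℕ)
  | S (j : ℕ)
  | T (j : ℕ)
  | CX (c d : ℕ)
  | skip
  deriving DecidableEq, Inhabited

/-- Forgetting the placement proofs of a placed gate. [folklore] -/
def toSymGate {N : ℕ} : QGate cliffordT N → SymGate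
  | .gate .H e => .H (embH e 0)
  | .gate .S e => .S (embS e 0)
  | .gate .T e => .T (embT e 0)
  | .gate .CNOT e => .CX (embC e 0) (embC e 1)
  | .oracle _ _ => .skip

/-- **The symbolic state** of a Clifford+`T` circuit after some gates: the affine form carried by
every wire, the Clifford phase data accumulated so far, the forms seen by the `T` gates (in
order), and the number of path variables allocated (one per Hadamard gate).
[cite: BravyiGosset2016, §II and App. B (affine spaces and quadratic forms tracking a Clifford computation)] -/
structure SymState where
  /-- The affine form on each wire. -/
  forms : List AffForm
  /-- The accumulated phase `i^{μ + Λ·w} (−1)^{B(w)}` of `S` and `H` gates. -/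
  D : GData
  /-- The forms entering the `T` gates, in order of application. -/
  tforms : List AffForm
  /-- The number of path variables in use. -/
  nv : ℕ
  deriving Inhabited

namespace SymState

/-- The form on wire `j` (constant `0` beyond the register). [folklore] -/
def form (σ : SymState) (j : ℕ) : AffForm := σ.forms.getD j (AffForm.const false)

/-- The initial symbolic state of the basis state `|y⟩`: constant forms, no phase, no variables.
[folklore] -/
def init {N : ℕ} (y : QReg N) : SymState := ⟨List.ofFn fun j => AffForm.const (y j), ⟨0, [], []⟩, [], 0⟩

/-- **One symbolic gate.** `H_j`: wire `j` becomes the fresh variable `w_k` and the phase gains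
`(−1)^{[old form_j] · w_k}`; `S_j`: phase `i^{[form_j]}`; `T_j`: record `form_j`;
`CNOT_{c→d}`: `form_d ⊕= form_c`. [cite: BravyiGosset2016, §II] -/
def step : SymGate → SymState → SymState
  | .H j, σ => ⟨σ.forms.set j (AffForm.unit σ.nv), GData.addQuadProduct (σ.form j) (AffForm.unit σ.nv) σ.D,
      σ.tforms, σ.nv + 1⟩
  | .S j, σ => ⟨σ.forms, GData.addPhaseForm 1 (σ.form j) σ.D, σ.tforms, σ.nv⟩
  | .T j, σ => ⟨σ.forms, σ.D, σ.tforms ++ [σ.form j], σ.nv⟩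
  | .CX c d, σ => ⟨σ.forms.set d ((σ.form d).add (σ.form c)), σ.D, σ.tforms, σ.nv⟩
  | .skip, σ => σ

/-- **Symbolic execution** of a gate list (a left fold, first gate first). [folklore] -/
def exec (gs : List SymGate) (σ : SymState) : SymState := gs.foldl (fun σ g => step g σ) σ

/-- Executing a cons. [folklore] -/
@[simp] theorem exec_cons (g : SymGate) (gs : List SymGate) (σ : SymState) :
    exec (g :: gs) σ = exec gs (step g σ) := rfl

/-- Executing the empty list. [folklore] -/
@[simp] theorem exec_nil (σ : SymState) : exec [] σ = σ := rfl

/-- Executing a concatenation. [folklore] -/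
theorem exec_append (gs gs' : List SymGate) (σ : SymState) : exec (gs ++ gs') σ = exec gs' (exec gs σ) :=
  List.foldl_append

/-- The basis label of the path `w` at this state: the values of the wire forms. [folklore] -/
def label {V : ℕ} (N : ℕ) (σ : SymState) (w : Fin V → Bool) : QReg N := fun j => (σ.form j).eval w

/-- The number of `T` gates traversed on a `1` by the path `w`. [folklore] -/
def tcount {V : ℕ} (σ : SymState) (w : Fin V → Bool) : ℕ := (σ.tforms.map fun f => Bool.toNat (f.eval w)).sum

/-- The phase of the path `w` at this state: Clifford part times `ω^{tcount}`. [folklore] -/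
def phase (V : ℕ) (σ : SymState) (w : Fin V → Bool) : ℂ := σ.D.val V w * omega ^ σ.tcount w

/-- **No form mentions a variable `≥ nv`.** [folklore] -/
def Supp (σ : SymState) : Prop :=
  ∀ p, σ.nv ≤ p → (∀ j, (σ.form j).coef p = false) ∧ (∀ f ∈ σ.tforms, f.coef p = false) ∧ σ.D.Unused p

/-! ### Reading and updating the wire forms -/

/-- The form list keeps its length under `step`. [folklore] -/
theorem length_forms_step (g : SymGate) (σ : SymState) : (step g σ).forms.length = σ.forms.length := by
  cases g <;> simp [step]

/-- The form list keeps its length under `exec`. [folklore] -/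
theorem length_forms_exec (gs : List SymGate) (σ : SymState) : (exec gs σ).forms.length = σ.forms.length := by
  induction gs generalizing σ with
  | nil => rfl
  | cons g gs ih => rw [exec_cons, ih, length_forms_step]

/-- The variable counter under `step`: `+1` exactly at Hadamard gates. [folklore] -/
theorem nv_step (g : SymGate) (σ : SymState) :
    (step g σ).nv = σ.nv + (match g with | .H _ => 1 | _ => 0) := by
  cases g <;> simp [step]

/-- Reading a form after `List.set`. [folklore] -/
theorem form_set (σ : SymState) (d : ℕ) (f : AffForm) (j : ℕ) (hd : d < σ.forms.length) (x : GData)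
    (y : List AffForm) (z : ℕ) :
    (⟨σ.forms.set d f, x, y, z⟩ : SymState).form j = if j = d then f else σ.form j := by
  unfold form
  simp only
  rw [List.getD_eq_getElem?_getD, List.getElem?_set]
  by_cases h : d = j
  · subst h; simp [hd]
  · rw [if_neg h, if_neg (Ne.symm h), List.getD_eq_getElem?_getD]

/-! ### Preservation of `Supp` -/

/-- `step` preserves `Supp` (the fresh variable of an `H` gate is the old counter, below the new
one). [folklore] -/
theorem Supp.step {σ : SymState} (hσ : σ.Supp) (g : SymGate) : (SymState.step g σ).Supp := by
  intro p hp
  cases g with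
  | H j =>
    simp only [SymState.step] at hp ⊢
    have hp' : σ.nv ≤ p := by omega
    have hpne : p ≠ σ.nv := by omega
    obtain ⟨h1, h2, h3⟩ := hσ p hp'
    have hu : (AffForm.unit σ.nv).coef p = false := by rw [AffForm.coef_unit]; simp [hpne]
    refine ⟨fun i => ?_, h2, h3.addQuadProduct (h1 j) hu⟩
    unfold form
    simp only
    rw [List.getD_eq_getElem?_getD, List.getElem?_set]
    split
    · split
      · exact hu
      · simp
    · rw [← List.getD_eq_getElem?_getD]; exact h1 i
  | S j =>
    obtain ⟨h1, h2, h3⟩ := hσ p hp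
    exact ⟨h1, h2, h3.addPhaseForm 1 (h1 j)⟩
  | T j =>
    obtain ⟨h1, h2, h3⟩ := hσ p hp
    refine ⟨h1, fun f hf => ?_, h3⟩
    simp only [SymState.step, List.mem_append, List.mem_singleton] at hf
    rcases hf with hf | rfl
    · exact h2 f hf
    · exact h1 j
  | CX c d =>
    obtain ⟨h1, h2, h3⟩ := hσ p hp
    refine ⟨fun i => ?_, h2, h3⟩
    unfold form
    simp only [SymState.step]
    rw [List.getD_eq_getElem?_getD, List.getElem?_set]
    split
    · split
      · show ((σ.form d).add (σ.form c)).coef p = false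
        rw [AffForm.coef_add, h1 d, h1 c]; rfl
      · simp
    · rw [← List.getD_eq_getElem?_getD]; exact h1 i
  | skip => exact hσ p hp

/-- `exec` preserves `Supp`. [folklore] -/
theorem Supp.exec {σ : SymState} (hσ : σ.Supp) (gs : List SymGate) : (SymState.exec gs σ).Supp := by
  induction gs generalizing σ with
  | nil => exact hσ
  | cons g gs ih => exact ih (hσ.step g)

/-- The initial state satisfies `Supp`. [folklore] -/
theorem supp_init {N : ℕ} (y : QReg N) : (init y).Supp := by
  intro p _
  refine ⟨fun j => ?_, fun f hf => by simp [init] at hf, GData.unused_empty 0 p⟩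
  unfold form init
  simp only
  rw [List.getD_eq_getElem?_getD, List.getElem?_ofFn]
  split <;> simp [AffForm.coef_const]

/-- Under `Supp`, nothing depends on a variable `p ≥ nv`: wire forms. [folklore] -/
theorem Supp.label_update {V N : ℕ} {σ : SymState} (hσ : σ.Supp) (w : Fin V → Bool) (p : Fin V)
    (hp : σ.nv ≤ p) (c : Bool) : σ.label N (Function.update w p c) = σ.label N w := by
  funext j
  exact AffForm.eval_update_of_coef _ w p c ((hσ p hp).1 j)

/-- Under `Supp`, nothing depends on a variable `p ≥ nv`: the `T`-count. [folklore] -/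
theorem Supp.tcount_update {V : ℕ} {σ : SymState} (hσ : σ.Supp) (w : Fin V → Bool) (p : Fin V)
    (hp : σ.nv ≤ p) (c : Bool) : σ.tcount (Function.update w p c) = σ.tcount w := by
  unfold tcount
  congr 1
  refine List.map_congr_left fun f hf => ?_
  rw [AffForm.eval_update_of_coef f w p c ((hσ p hp).2.1 f hf)]

/-- Under `Supp`, nothing depends on a variable `p ≥ nv`: the phase. [folklore] -/
theorem Supp.phase_update {V : ℕ} {σ : SymState} (hσ : σ.Supp) (w : Fin V → Bool) (p : Fin V)
    (hp : σ.nv ≤ p) (c : Bool) : σ.phase V (Function.update w p c) = σ.phase V w := by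
  unfold phase
  rw [GData.val_update_of_unused σ.D (hσ p hp).2.2 w c, hσ.tcount_update w p hp c]

/-! ### Overriding a block of variables -/

/-- `ovr w k v`: the valuation `w` with the variables `k, …, k + n − 1` overridden by `v`.
[folklore] -/
def ovr {V n : ℕ} (w : Fin V → Bool) (k : ℕ) (v : Fin n → Bool) : Fin V → Bool :=
  fun j => if h : k ≤ (j : ℕ) ∧ (j : ℕ) < k + n then v ⟨j - k, by omega⟩ else w j

/-- Overriding an empty block does nothing. [folklore] -/
theorem ovr_zero {V : ℕ} (w : Fin V → Bool) (k : ℕ) (v : Fin 0 → Bool) : ovr w k v = w := by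
  funext j
  unfold ovr
  rw [dif_neg]
  omega

/-- Overriding `k, …, k + n` by `(c, v)` is overriding `k` by `c` and then `k + 1, …` by `v`.
[folklore] -/
theorem ovr_cons {V n : ℕ} (w : Fin V → Bool) (k : ℕ) (hk : k < V) (c : Bool) (v : Fin n → Bool) :
    ovr w k (Fin.cons c v : Fin (n + 1) → Bool) = ovr (Function.update w ⟨k, hk⟩ c) (k + 1) v := by
  funext j
  unfold ovr
  by_cases h1 : k ≤ (j : ℕ) ∧ (j : ℕ) < k + (n + 1)
  · rw [dif_pos h1]
    by_cases h2 : (j : ℕ) = k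
    · rw [dif_neg (by omega)]
      have hj : j = ⟨k, hk⟩ := Fin.ext h2
      subst hj
      rw [Function.update_self]
      have : (⟨k - k, by omega⟩ : Fin (n + 1)) = 0 := Fin.ext (by simp)
      exact (congrArg (Fin.cons c v : Fin (n + 1) → Bool) this).trans (Fin.cons_zero _ _)
    · rw [dif_pos (by omega)]
      have : (⟨(j : ℕ) - k, by omega⟩ : Fin (n + 1)) = Fin.succ ⟨(j : ℕ) - (k + 1), by omega⟩ :=
        Fin.ext (by simp; omega)
      exact (congrArg (Fin.cons c v : Fin (n + 1) → Bool) this).trans (Fin.cons_succ _ _ _)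
  · rw [dif_neg h1, dif_neg (by omega), Function.update_of_ne]
    exact fun h => h1 (by subst h; simp)

/-! ### The path-sum theorem -/

/-- `ω⁴ = −1` as a power of `−1`: `ω^{4b} = (−1)^b`. [folklore] -/
theorem omega_pow_four_mul (b : ℕ) : omega ^ (4 * b) = (-1 : ℂ) ^ b := by
  rw [pow_mul, omega_pow_four]

/-- `ω^{2b} = i^b`. [folklore] -/
theorem omega_pow_two_mul (b : ℕ) : omega ^ (2 * b) = I ^ b := by
  rw [pow_mul, omega_pow_two]

/-- The symbolic state of a gate list over a placed circuit. [folklore] -/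
abbrev execGates {N : ℕ} (gs : List (QGate cliffordT N)) (σ : SymState) : SymState :=
  exec (gs.map toSymGate) σ

/-- **The path-sum theorem for symbolic execution.** For an oracle-free gate list `gs` with `h'`
Hadamard gates, a symbolic state `σ` on `N` wires satisfying `Supp` whose counter `k` leaves room
for `h'` more variables below `V`, and any ambient valuation `w`:
`(1/√2)^{h'} Σ_{v ∈ 𝔽₂^{h'}} phase_{σ'}(w[k.. := v]) |label_{σ'}(w[k.. := v])⟩ = phase_σ(w) · U_{gs} |label_σ(w)⟩`
with `σ' = symExec gs σ`. (Gate by gate: `H` opens a new binary branch — a new variable — with sign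
`(−1)^{in·out}`; `S`, `T`, `CNOT` act on labels and phases as recorded by `step`;
Nielsen–Chuang 2010, §4.2.) [cite: BravyiGosset2016, §II] -/
theorem symExec_spec {N V : ℕ} (gs : List (QGate cliffordT N)) (hgs : ∀ g ∈ gs, g.IsOracleFree)
    (h' : ℕ) (hh : hCount gs = h') (σ : SymState) (hlen : σ.forms.length = N) (hσ : σ.Supp)
    (hV : σ.nv + h' ≤ V) (w : Fin V → Bool) :
    (invSqrt2 ^ h') • ∑ v : Fin h' → Bool,
        (execGates gs σ).phase V (ovr w σ.nv v) • basisState ((execGates gs σ).label N (ovr w σ.nv v)) =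
      σ.phase V w • (prodZeta omega gs *ᵥ basisState (σ.label N w)) := by
  induction gs generalizing h' σ w with
  | nil =>
    simp only [hCount_nil] at hh
    subst hh
    simp [execGates, ovr_zero]
  | cons g rest ih =>
    have hg : g.IsOracleFree := hgs g (by simp)
    have hrest : ∀ g' ∈ rest, g'.IsOracleFree := fun g' h => hgs g' (by simp [h])
    rw [prodZeta_cons, ← Matrix.mulVec_mulVec,
      semZeta_mulVec_basisState omega_pow_two hg, Matrix.mulVec_sum, Fintype.sum_bool, smul_add]
    simp only [execGates, List.map_cons, exec_cons]
    rw [hCount_cons] at hh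
    cases g with
    | oracle k e => exact absurd hg id
    | gate op e =>
      cases op with
      | H =>
        -- the Hadamard gate: a fresh variable
        simp only [QGateIsH, if_true] at hh
        subst hh
        set i : Fin N := embH e 0 with hi
        set σ₁ := step (toSymGate (QGate.gate CliffordTOp.H e)) σ with hσ₁
        have hσ₁' : σ₁ = step (.H i) σ := rfl
        have hkV : σ.nv < V := by omega
        set kF : Fin V := ⟨σ.nv, hkV⟩ with hkF
        have hlen₁ : σ₁.forms.length = N := by rw [hσ₁', length_forms_step, hlen]
        have hnv₁ : σ₁.nv = σ.nv + 1 := rfl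
        have hiN : (i : ℕ) < σ.forms.length := by rw [hlen]; exact i.2
        -- label and phase after the gate, at `w[k ↦ c]`
        have hlab : ∀ c : Bool, σ₁.label N (Function.update w kF c) =
            Function.update (σ.label N w) i c := by
          intro c
          funext j
          unfold label
          rw [hσ₁']
          simp only [step]
          rw [form_set σ i _ j hiN]
          by_cases hji : j = i
          · subst hji
            rw [if_pos rfl, Function.update_self, AffForm.eval_unit σ.nv hkV]
            simp [hkF]
          · rw [if_neg (fun h => hji (Fin.ext h)), Function.update_of_ne hji,
              AffForm.eval_update_of_coef _ w kF c ((hσ σ.nv le_rfl).1 j)]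
        have hph : ∀ c : Bool, σ₁.phase V (Function.update w kF c) =
            σ.phase V w * (-1 : ℂ) ^ Bool.toNat ((σ.label N w) i && c) := by
          intro c
          unfold phase
          rw [hσ₁']
          simp only [step]
          rw [GData.val_addQuadProduct, AffForm.eval_unit σ.nv hkV,
            AffForm.eval_update_of_coef _ w kF c ((hσ σ.nv le_rfl).1 i),
            GData.val_update_of_unused σ.D (hσ σ.nv le_rfl).2.2 w c]
          have ht : tcount ⟨σ.forms.set i (AffForm.unit σ.nv), GData.addQuadProduct (σ.form i) (AffForm.unit σ.nv) σ.D,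
              σ.tforms, σ.nv + 1⟩ (Function.update w kF c) = σ.tcount w := by
            have := hσ.tcount_update w kF le_rfl c
            unfold tcount at this ⊢
            exact this
          rw [ht]
          simp only [hkF, Function.update_self]
          unfold label
          ring
        -- split the sum over `v : Fin (h'' + 1) → Bool` along the first coordinate
        rw [← (Fin.consEquiv fun _ => Bool).sum_comp, Fintype.sum_prod_type, Fintype.sum_bool,
          smul_add]
        have hcons : ∀ (c : Bool) (v : Fin (hCount rest) → Bool),
            ovr w σ.nv ((Fin.consEquiv fun _ => Bool) (c, v)) =
              ovr (Function.update w kF c) σ₁.nv v := fun c v => by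
          rw [hnv₁]; exact ovr_cons w σ.nv hkV c v
        simp only [hcons]
        have hσ₁s : σ₁.Supp := hσ.step _
        have hV₁ : σ₁.nv + hCount rest ≤ V := by rw [hnv₁]; omega
        have key : ∀ c : Bool,
            invSqrt2 ^ (hCount rest + 1) • ∑ v : Fin (hCount rest) → Bool,
              (exec (rest.map toSymGate) σ₁).phase V (ovr (Function.update w kF c) σ₁.nv v) •
                basisState ((exec (rest.map toSymGate) σ₁).label N (ovr (Function.update w kF c) σ₁.nv v)) =
            σ.phase V w • (prodZeta omega rest *ᵥ stepVec omega (QGate.gate CliffordTOp.H e) c (σ.label N w)) := by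
          intro c
          rw [pow_succ, mul_comm, mul_smul]
          have := ih hrest (hCount rest) rfl σ₁ hlen₁ hσ₁s hV₁ (Function.update w kF c)
          rw [show execGates rest σ₁ = exec (rest.map toSymGate) σ₁ from rfl] at this
          rw [this, hph c, hlab c, smul_smul]
          unfold stepVec pathStep
          simp only [hCoef, QGateIsH, if_true, Matrix.mulVec_smul, smul_smul]
          rw [← hi]
          congr 1
          cases (σ.label N w) i <;> cases c <;> simp [omega_pow_four] <;> ring
        rw [key true, key false, add_comm]
      | S =>
        simp only [QGateIsH, Bool.false_eq_true, if_false, add_zero] at hh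
        set i : Fin N := embS e 0 with hi
        set σ₁ := step (toSymGate (QGate.gate CliffordTOp.S e)) σ with hσ₁
        have hσ₁' : σ₁ = step (.S i) σ := rfl
        have hlen₁ : σ₁.forms.length = N := by rw [hσ₁', length_forms_step, hlen]
        have hnv₁ : σ₁.nv = σ.nv := rfl
        have hlab : σ₁.label N w = σ.label N w := rfl
        have hph : σ₁.phase V w = σ.phase V w * I ^ Bool.toNat ((σ.label N w) i) := by
          unfold phase
          rw [hσ₁']
          simp only [step]
          rw [GData.val_addPhaseForm, pow_one]
          unfold label tcount
          ring
        have := ih hrest h' hh σ₁ hlen₁ (hσ.step _) (by rw [hnv₁]; exact hV) w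
        rw [show execGates rest σ₁ = exec (rest.map toSymGate) σ₁ from rfl, hnv₁] at this
        rw [this, hph, hlab]
        unfold stepVec pathStep
        simp only [hCoef, QGateIsH, Bool.false_eq_true, if_false, if_true, one_mul, smul_zero,
          Matrix.mulVec_zero, zero_add, Matrix.mulVec_smul, smul_smul]
        congr 1
        rw [← hi]
        cases (σ.label N w) i <;> simp [omega_pow_two]
      | T =>
        simp only [QGateIsH, Bool.false_eq_true, if_false, add_zero] at hh
        set i : Fin N := embT e 0 with hi
        set σ₁ := step (toSymGate (QGate.gate CliffordTOp.T e)) σ with hσ₁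
        have hσ₁' : σ₁ = step (.T i) σ := rfl
        have hlen₁ : σ₁.forms.length = N := by rw [hσ₁', length_forms_step, hlen]
        have hnv₁ : σ₁.nv = σ.nv := rfl
        have hlab : σ₁.label N w = σ.label N w := rfl
        have hph : σ₁.phase V w = σ.phase V w * omega ^ Bool.toNat ((σ.label N w) i) := by
          unfold phase tcount
          rw [hσ₁']
          simp only [step, List.map_append, List.map_cons, List.map_nil, List.sum_append,
            List.sum_cons, List.sum_nil, add_zero, pow_add]
          unfold label
          ring
        have := ih hrest h' hh σ₁ hlen₁ (hσ.step _) (by rw [hnv₁]; exact hV) w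
        rw [show execGates rest σ₁ = exec (rest.map toSymGate) σ₁ from rfl, hnv₁] at this
        rw [this, hph, hlab]
        unfold stepVec pathStep
        simp only [hCoef, QGateIsH, Bool.false_eq_true, if_false, if_true, one_mul, smul_zero,
          Matrix.mulVec_zero, zero_add, Matrix.mulVec_smul, smul_smul]
        rw [← hi]
        congr 1
        cases (σ.label N w) i <;> simp
      | CNOT =>
        simp only [QGateIsH, Bool.false_eq_true, if_false, add_zero] at hh
        set σ₁ := step (toSymGate (QGate.gate CliffordTOp.CNOT e)) σ with hσ₁
        have hσ₁' : σ₁ = step (.CX (embC e 0) (embC e 1)) σ := rfl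
        have hlen₁ : σ₁.forms.length = N := by rw [hσ₁', length_forms_step, hlen]
        have hnv₁ : σ₁.nv = σ.nv := rfl
        have hdN : ((embC e 1 : Fin N) : ℕ) < σ.forms.length := by rw [hlen]; exact (embC e 1).2
        have hlab : σ₁.label N w = Function.update (σ.label N w) (embC e 1)
            ((σ.label N w) (embC e 1) ^^ (σ.label N w) (embC e 0)) := by
          funext j
          unfold label
          rw [hσ₁']
          simp only [step]
          rw [form_set σ (embC e 1) _ j hdN]
          by_cases hj : j = embC e 1
          · subst hj
            rw [if_pos rfl, Function.update_self, AffForm.eval_add]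
          · rw [if_neg (fun h => hj (Fin.ext h)), Function.update_of_ne hj]
        have hph : σ₁.phase V w = σ.phase V w := rfl
        have := ih hrest h' hh σ₁ hlen₁ (hσ.step _) (by rw [hnv₁]; exact hV) w
        rw [show execGates rest σ₁ = exec (rest.map toSymGate) σ₁ from rfl, hnv₁] at this
        rw [this, hph, hlab]
        unfold stepVec pathStep
        simp only [hCoef, QGateIsH, Bool.false_eq_true, if_false, if_true, one_mul, smul_zero,
          Matrix.mulVec_zero, zero_add, pow_zero, one_smul]

/-- The initial state: all wires, no phase. [folklore] -/
theorem label_init {N V : ℕ} (y : QReg N) (w : Fin V → Bool) : (init y).label N w = y := by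
  funext j
  unfold label form init
  simp only
  rw [List.getD_eq_getElem?_getD, List.getElem?_ofFn]
  simp [AffForm.eval_const]

/-- The initial state: phase `1`. [folklore] -/
theorem phase_init {N V : ℕ} (y : QReg N) (w : Fin V → Bool) : (init y).phase V w = 1 := by
  unfold phase tcount init GData.val GData.expI GData.expNeg
  simp [GData.lamAt, GData.entry]

/-- The initial state has `N` wire forms. [folklore] -/
theorem length_forms_init {N : ℕ} (y : QReg N) : (init y).forms.length = N := by simp [init]

/-- **Amplitudes as symbolic path sums.** For an oracle-free gate list `gs` with `h` Hadamard
gates, `V ≥ h` ambient variables, any ambient valuation `w`, and the final symbolic state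
`σ = symExec gs (init y)`:
`⟨z| U_{gs} |y⟩ = (1/√2)^h Σ_{v ∈ 𝔽₂^h} [label_σ(w[0.. := v]) = z] · phase_σ(w[0.. := v])`.
[cite: BravyiGosset2016, §II] -/
theorem prodZeta_apply_eq_sum {N V : ℕ} (gs : List (QGate cliffordT N)) (hgs : ∀ g ∈ gs, g.IsOracleFree)
    (hV : hCount gs ≤ V) (y z : QReg N) (w : Fin V → Bool) :
    (prodZeta omega gs *ᵥ basisState y) z =
      invSqrt2 ^ hCount gs * ∑ v : Fin (hCount gs) → Bool,
        if (execGates gs (init y)).label N (ovr w 0 v) = z then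
          (execGates gs (init y)).phase V (ovr w 0 v) else 0 := by
  have h := symExec_spec gs hgs (hCount gs) rfl (init y) (length_forms_init y) (supp_init y)
    (by simp [init]; exact hV) w
  rw [phase_init, label_init, one_smul] at h
  rw [← h]
  simp only [init, Pi.smul_apply, Finset.sum_apply, smul_eq_mul, basisState_apply, mul_ite, mul_one,
    mul_zero]
  congr 1
  refine Finset.sum_congr rfl fun v _ => ?_
  simp only [eq_comm (a := z)]

end SymState

end Literature.Computability.QuantumComplexity.BravyiGosset

end
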